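import Literature.NumberTheory.Transcendental.LinearSubgroupTheoremAssembly
import Literature.Barriers.Schanuel.AlgebraicIndependenceOfLogarithmsRoyThm1FromLST
import HarnessLib

/-!
# Barrier (Schanuel): Roy 1992, Theorem 1 — the period-free Linear Subgroup Theorem in Roy's setting, from a zero estimate and an auxiliary function

Companion (everything proved; no definitions, no named facts) of the named fact
`Literature.Barriers.Schanuel.roy1992_thm1`
(`Literature.Barriers.Schanuel.AlgebraicIndependenceOfLogarithmsRoyThm12`). The chain of
reductions proved in `AlgebraicIndependenceOfLogarithmsRoyThm1FromLST.lean`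
(`roy1992_thm1_of_weak`, `roy1992_thm1_weak_of_linearSubgroupTheorem_weak`) leaves, for each
object `(K^{d₀} × K^{d₁}, Y, W, V)` of Roy's category, the period-free conclusion of
[Waldschmidt1988, Thm 4.1] on the tangent space: an obstruction `E × F` (`E ⊆ ℂ^{d₀}` any
subspace, `F ⊆ ℂ^{d₁}` a `ℚ`-rational subspace) with `E × F + W ≠ K^{d₀} × K^{d₁}` and
`(λ + δ₁)(d − n) ≤ (δ − τ) d₁`. `Roy1992.weakLinearSubgroup_of_zeroEstimate_of_auxiliary` below
supplies exactly that conclusion from the two analytic/algebraic inputs of [Waldschmidt1988, §7]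
taken as explicit hypotheses — Philippon's zero estimate on `𝔾ₐ^{d₀} × 𝔾ₘ^{d₁}` (`hZE`) and the
auxiliary function of Prop. 6.1 for a basis of `Y` (`hAF`) — by choosing a `ℚ`-basis of `Y` and
invoking `Literature.NumberTheory.Transcendental.LinGroup.weakObstruction_of_zeroEstimate_of_auxiliary`
(`LinearSubgroupTheoremAssembly.lean`, where the §7 argument is carried out). So the discharge of
`roy1992_thm1` is reduced to PROVING those two hypotheses (the zero estimate exists in the tree
for `d₀ = 1` as `Philippon1986_GaGm_holds`).

## References

* [Waldschmidt1988] M. Waldschmidt, *On the transcendence methods of Gel'fond and Schneider in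
  several variables*, New Advances in Transcendence Theory (A. Baker ed.), CUP 1988, 375–398:
  §4 Theorem 4.1 (pp. 382–383); §6 Prop. 6.1 (p. 389); §7 (p. 390).
* [Roy1992] D. Roy, *Matrices whose coefficients are linear forms in logarithms*, J. Number
  Theory 41 (1992) 22–47, §1 Theorem 1 (p. 25).
-/

noncomputable section

/-! ### The statement owed to `roy1992_thm1_of_weak`: the period-free Linear Subgroup Theorem in Roy's setting -/

namespace Literature.Barriers.Schanuel.Roy1992

open Module Submodule Complex Literature.NumberTheory.Transcendental
  Literature.NumberTheory.Transcendental.LinGroup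

/-- **The hypothesis of `roy1992_thm1_weak_of_linearSubgroupTheorem_weak`, for one object
`(K^{d₀} × K^{d₁}, Y, W, V)`, from the zero estimate and the auxiliary function.** Choose a
`ℚ`-basis `y₁, …, y_m` of `Y` and apply `LinGroup.weakObstruction_of_zeroEstimate_of_auxiliary`
with `n = dim V < d₀ + d₁`; the obstruction `G' = E × T'` gives `E` (over `ℂ`), `F = Lie T'`
(`ℚ`-rational, `LinGroup.ConnAlgSubgroup.torusTangent_le_span_rat`), `δ > τ`, and
`(λ + δ₁)(d − n) ≤ (δ − τ) d₁` with `λ = dim_ℚ Y − dim_ℚ(Y ∩ (Lie G' + Ω))`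
(`LinGroup.finrank_comap_lattQ`). The auxiliary function is required for the chosen basis only
through `hAF`, which asks it for every basis of `Y`.
[cite: Waldschmidt1988, §4 Theorem 4.1 (pp. 382–383); §7 (p. 390)]
[cite: Roy1992, §1 Theorem 1 (p. 25)] -/
theorem weakLinearSubgroup_of_zeroEstimate_of_auxiliary {d₀ d₁ : ℕ} (c : ℕ)
    (hZE : ∀ (D₀ D₁ T : ℕ) (W : Submodule ℂ (LinTangent d₀ d₁))
        (S : Set (LinGroup d₀ d₁)) (P : MvPolynomial (Fin d₀ ⊕ Fin d₁) ℂ),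
      1 ≤ D₀ → 1 ≤ D₁ → 0 < finrank ℂ W → S.Finite → (1 : LinGroup d₀ d₁) ∈ S → P ≠ 0 →
      degX P ≤ D₀ → degY P ≤ D₁ →
      (∀ g ∈ sumset S (d₀ + d₁), VanishesToOrder P W g ((d₀ + d₁) * T + 1)) →
      ∃ H : ConnAlgSubgroup d₀ d₁,
        (∃ g : LinGroup d₀ d₁, ∀ h ∈ H.toSubgroup, evalAt P (g * h) = 0) ∧
        Nat.choose (T + (finrank ℂ W - finrank ℂ ↥(W ⊓ H.tangent)))
            (finrank ℂ W - finrank ℂ ↥(W ⊓ H.tangent)) *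
          Set.ncard ((QuotientGroup.mk : LinGroup d₀ d₁ → LinGroup d₀ d₁ ⧸ H.toSubgroup) '' S) *
          D₀ ^ H.addDim * D₁ ^ H.torusDim ≤ c * D₀ ^ d₀ * D₁ ^ d₁)
    (Y : Submodule ℚ (LinTangent d₀ d₁)) (W V : Submodule ℂ (LinTangent d₀ d₁))
    (hfin : FiniteDimensional ℚ Y) (hV : V ≠ ⊤)
    (hAF : ∀ {m : ℕ} (y : Fin m → LinTangent d₀ d₁), LinearIndependent ℚ y →
      Submodule.span ℚ (Set.range y) = Y →
      ∃ (C : ℝ) (S₀ : ℕ), 1 ≤ C ∧ ∀ S : ℕ, S₀ ≤ S →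
        ∃ (P : MvPolynomial (Fin d₀ ⊕ Fin d₁) ℂ) (T : ℕ), P ≠ 0 ∧
          auxDelta C d₀ d₁ (finrank ℂ V) S / Real.log S ≤ T ∧
          (degX P : ℝ) ≤ auxDelta C d₀ d₁ (finrank ℂ V) S / Real.log S ^ 2 ∧
          (degY P : ℝ) ≤ auxDelta C d₀ d₁ (finrank ℂ V) S / S ∧
          ∀ h : Fin m → ℕ, (∀ j, h j ≤ S) →
            VanishesToOrder P W (LinGroup.exp (latt y fun j => (h j : ℤ))) T) :
    ∃ (E : Submodule ℂ (Fin d₀ → ℂ)) (F : Submodule ℂ (Fin d₁ → ℂ)),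
      F ≤ span ℂ {v | v ∈ F ∧ ∀ j, v j ∈ Set.range ((↑) : ℚ → ℂ)} ∧
      E.prod F ⊔ W ≠ ⊤ ∧
      (finrank ℚ Y - finrank ℚ ↥(Y ⊓ ((E.prod F).restrictScalars ℚ ⊔ Omega d₀ d₁))
          + (d₁ - finrank ℂ F)) * (d₀ + d₁ - finrank ℂ V) ≤
        (d₀ + d₁ - finrank ℂ ↥(E.prod F ⊔ W)) * d₁ := by
  haveI := hfin
  -- a `ℚ`-basis of `Y`
  set m := finrank ℚ Y with hm
  let b : Basis (Fin m) ℚ Y := finBasis ℚ Y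
  let y : Fin m → LinTangent d₀ d₁ := fun i => (b i : LinTangent d₀ d₁)
  have hy : LinearIndependent ℚ y := b.linearIndependent.map' Y.subtype Y.ker_subtype
  have hyY : Submodule.span ℚ (Set.range y) = Y := (eq_span_range_basis Y b).symm
  -- `n = dim V < d₀ + d₁`
  have hn : finrank ℂ V < d₀ + d₁ := by
    have hle : finrank ℂ V ≤ d₀ + d₁ := by
      rw [← finrank_linTangent d₀ d₁]
      exact Submodule.finrank_le _
    refine lt_of_le_of_ne hle fun heq => hV ?_
    exact Submodule.eq_top_of_finrank_eq (by rw [finrank_linTangent]; exact heq)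
  obtain ⟨H, hne, hineq⟩ :=
    weakObstruction_of_zeroEstimate_of_auxiliary y W c hZE hn (hAF y hy hyY)
  refine ⟨H.addPart, H.torusTangent, H.torusTangent_le_span_rat, hne, ?_⟩
  have e1 : finrank ℚ ((H.tangent.restrictScalars ℚ ⊔ Omega d₀ d₁).comap (lattQ y)) =
      finrank ℚ ↥(Y ⊓ ((H.addPart.prod H.torusTangent).restrictScalars ℚ ⊔ Omega d₀ d₁)) := by
    rw [finrank_comap_lattQ y hy, hyY]
    rfl
  rw [e1] at hineq
  exact hineq

end Literature.Barriers.Schanuel.Roy1992
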